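/-
Copyright: harness tree, Literature layer (sorry-free). b2b-lace enum2-g12 (ENUMERATION SHARD B gen 12),
GAPS G8 (δ2)(i), SEEDCERT_U L4 in its certificate form `|√(2πu) F(u) - P(1/u)| ≤ ε u^{-(J+1)}`.
-/
import Literature.Probability.LatticeModels.SRWHeatKernelBracket
import Mathlib.Analysis.SpecialFunctions.Gamma.Basic
import HarnessLib

/-!
# The large-`u` bracket of `√(2πu) e^{-u} I_m(u)` in certificate form

From the generic bracket `SRWHeatKernelBracket.srwHeatKernel_bracket` this file derives the form
used by the Poisson-split seed certificates (lemma L4 of the certificate format): for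
`0 < s₀ < 1`, `σ = s₀²`, `J : ℕ`, `T ≥ (J + 3/2)/(2σ)` and every `u ≥ T`,

  `|√(2πu) q_u(m) - Σ_i g_i (2i-1)‼/(4u)ⁱ| ≤ ε · u^{-(J+1)}`,                (`srwHeatKernel_bracket_eps`)
  `ε = β_{J+1}/(1-σ) · (2J+1)‼/4^{J+1} + √(2π) e^{-2Tσ} T^{J+3/2} (1 + (2/π) Σ_i |g_i| ν_i(T))`,
  `ν_i(T) = (2s₀)^{-1} Σ_{j≤i} C(i,j) j! σ^{i-j}/(2T)^{j+1}`                   (`bracketEps`),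

a `u`-free constant; ingredients: the closed form of the incomplete Gamma integral
`∫_σ^∞ tⁱ e^{-rt} dt = e^{-rσ} Σ_{j≤i} C(i,j) j! σ^{i-j}/r^{j+1}` (`integral_pow_mul_exp_neg_mul_Ioi_eq_exp_mul_complSum`,
shift `t = σ + v` and the Gamma integral), its monotonicity in `r`, and the monotonicity of
`u^{J+3/2} e^{-2σu}` for `u ≥ (J+3/2)/(2σ)` (`SRWHeatKernelHalfAngleBounds`).

References: R. Fitzner, R. van der Hofstad, Electron. J. Probab. 22 (2017), §5.1.1 (5.2)–(5.5),
pp. 1089–1090. [cite: FitznerVanDerHofstad2016NoBLE, §5.1.1 (5.2)-(5.5) p. 1089-1090];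
T. Hara, G. Slade, Rev. Math. Phys. 4 (1992), Appendix B. [cite: HaraSlade1992b, Appendix B]
-/

noncomputable section

open Real MeasureTheory Set Finset Polynomial.Chebyshev
open Literature.Probability.FitznerVanDerHofstad2017
open scoped Nat

namespace Literature.Probability.LatticeModels

/-! ## The incomplete Gamma integral `∫_σ^∞ tⁱ e^{-rt} dt` -/

/-- `complSum i σ r = Σ_{j ≤ i} C(i,j) j! σ^{i-j} / r^{j+1}` (`= e^{rσ} ∫_σ^∞ tⁱ e^{-rt} dt`). [folklore] -/
def complSum (i : ℕ) (σ r : ℝ) : ℝ :=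
  ∑ j ∈ range (i + 1), (i.choose j : ℝ) * (j ! : ℝ) * σ ^ (i - j) / r ^ (j + 1)

/-- `complSum i σ r ≥ 0` for `σ ≥ 0`, `r > 0`. [folklore] -/
theorem complSum_nonneg (i : ℕ) {σ r : ℝ} (hσ : 0 ≤ σ) (hr : 0 < r) : 0 ≤ complSum i σ r := by
  unfold complSum
  exact Finset.sum_nonneg fun j _ => by positivity

/-- `complSum` is non-increasing in `r > 0` (for `σ ≥ 0`). [folklore] -/
theorem complSum_anti (i : ℕ) {σ r r' : ℝ} (hσ : 0 ≤ σ) (hr : 0 < r) (hrr : r ≤ r') :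
    complSum i σ r' ≤ complSum i σ r := by
  unfold complSum
  refine Finset.sum_le_sum fun j _ => ?_
  have hn : 0 ≤ (i.choose j : ℝ) * (j ! : ℝ) * σ ^ (i - j) := by positivity
  exact div_le_div_of_nonneg_left hn (by positivity) (pow_le_pow_left₀ hr.le hrr _)

/-- **Closed form of the incomplete Gamma integral**: for `r > 0` and any real `σ`,
`∫_{(σ,∞)} tⁱ e^{-rt} dt = e^{-rσ} Σ_{j≤i} C(i,j) j! σ^{i-j}/r^{j+1}` (shift `t = v + σ`, binomial
theorem, `∫₀^∞ v^j e^{-rv} dv = j!/r^{j+1}`). [folklore] -/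
theorem integral_pow_mul_exp_neg_mul_Ioi_eq_exp_mul_complSum (i : ℕ) {r : ℝ} (σ : ℝ) (hr : 0 < r) :
    ∫ t in Ioi σ, t ^ i * Real.exp (-(r * t)) = Real.exp (-(r * σ)) * complSum i σ r := by
  -- the Gamma integrals
  have hGam : ∀ k : ℕ, ∫ v in Ioi (0 : ℝ), v ^ k * Real.exp (-(r * v)) = (k ! : ℝ) / r ^ (k + 1) := by
    intro k
    have h := Real.integral_rpow_mul_exp_neg_mul_Ioi (a := ((k + 1 : ℕ) : ℝ)) (by positivity) hr
    have e : ∀ v : ℝ, v ^ (((k + 1 : ℕ) : ℝ) - 1) = v ^ k := by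
      intro v
      rw [show (((k + 1 : ℕ) : ℝ) - 1) = ((k : ℕ) : ℝ) by push_cast; ring, Real.rpow_natCast]
    simp_rw [e] at h
    rw [h, Real.rpow_natCast, show ((k + 1 : ℕ) : ℝ) = (k : ℝ) + 1 by push_cast; ring,
      Real.Gamma_nat_eq_factorial, one_div, inv_pow, inv_mul_eq_div]
  have hInt : ∀ k : ℕ, IntegrableOn (fun v : ℝ => v ^ k * Real.exp (-(r * v))) (Ioi 0) :=
    fun k => integrableOn_pow_mul_exp_neg_mul_Ioi' k hr le_rfl
  -- shift
  have hcv := integral_image_eq_integral_abs_deriv_smul (s := Ioi (0 : ℝ))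
    (f := fun v : ℝ => v + σ) (f' := fun _ => (1 : ℝ)) measurableSet_Ioi
    (fun v _ => ((hasDerivAt_id v).add_const σ).hasDerivWithinAt)
    (fun a _ b _ hab => by simpa using hab)
    (fun t : ℝ => t ^ i * Real.exp (-(r * t)))
  rw [image_add_const_Ioi, zero_add] at hcv
  rw [hcv]
  -- expand the shifted integrand
  have hpt : ∀ v : ℝ, |(1 : ℝ)| • ((v + σ) ^ i * Real.exp (-(r * (v + σ))))
      = ∑ j ∈ range (i + 1), (Real.exp (-(r * σ)) * ((i.choose j : ℝ) * σ ^ (i - j)))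
          * (v ^ j * Real.exp (-(r * v))) := by
    intro v
    rw [abs_one, one_smul, add_pow, Finset.sum_mul]
    refine Finset.sum_congr rfl fun j _ => ?_
    rw [show -(r * (v + σ)) = -(r * v) + -(r * σ) by ring, Real.exp_add]
    ring
  simp_rw [hpt]
  rw [integral_finsetSum _ fun j _ => (hInt j).const_mul _]
  simp_rw [integral_const_mul, hGam]
  unfold complSum
  rw [Finset.mul_sum]
  refine Finset.sum_congr rfl fun j _ => ?_
  field_simp

/-! ## Step (e): `√u e^{-2uσ} ≤ T^{J+3/2} e^{-2Tσ} u^{-(J+1)}` for `u ≥ T ≥ (J+3/2)/(2σ)` -/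

/-- For `σ > 0`, `T ≥ (J+3/2)/(2σ)` and `u ≥ T`:
`√u e^{-2uσ} ≤ T^{J+3/2} e^{-2Tσ} (u^{J+1})⁻¹`. [folklore] -/
theorem sqrt_mul_exp_le {σ T u : ℝ} (hσ : 0 < σ) (J : ℕ) (hT : ((J : ℝ) + 3 / 2) / (2 * σ) ≤ T)
    (hu : T ≤ u) :
    √u * Real.exp (-(2 * u * σ))
      ≤ T ^ ((J : ℝ) + 3 / 2) * Real.exp (-(2 * T * σ)) * (u ^ (J + 1))⁻¹ := by
  have ha : 0 ≤ (J : ℝ) + 3 / 2 := by positivity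
  have hc : 0 < 2 * σ := by positivity
  have hT0 : 0 < T := lt_of_lt_of_le (div_pos (by positivity) hc) hT
  have hu0 : 0 < u := lt_of_lt_of_le hT0 hu
  have hmono := rpow_mul_exp_neg_mul_le_of_le ha hc hT hu
  have e1 : Real.exp (-(2 * σ * u)) = Real.exp (-(2 * u * σ)) := by ring_nf
  have e2 : Real.exp (-(2 * σ * T)) = Real.exp (-(2 * T * σ)) := by ring_nf
  rw [e1, e2] at hmono
  -- `√u = u^{J+3/2} (u^{J+1})⁻¹`
  have hsplit : √u = u ^ ((J : ℝ) + 3 / 2) * (u ^ (J + 1))⁻¹ := by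
    have h1 : u ^ ((J : ℝ) + 3 / 2) = u ^ (((J + 1 : ℕ) : ℝ)) * u ^ (1 / 2 : ℝ) := by
      rw [← Real.rpow_add hu0]; congr 1; push_cast; ring
    rw [h1, Real.rpow_natCast, Real.sqrt_eq_rpow]
    field_simp
  rw [hsplit, mul_right_comm]
  exact mul_le_mul_of_nonneg_right hmono (by positivity)

/-! ## The certificate form of the bracket -/

/-- The `u`-free error constant
`ε = β_{J+1}/(1-s₀²) (2J+1)‼/4^{J+1} + √(2π) e^{-2Ts₀²} T^{J+3/2} (1 + (2/π) Σ_i |g_i| (2s₀)^{-1} complSum i s₀² (2T))`.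
[cite: FitznerVanDerHofstad2016NoBLE, §5.1.1 (5.2)-(5.5) p. 1089-1090] -/
def bracketEps (m : ℤ) (J : ℕ) (s₀ T : ℝ) : ℝ :=
  invSqrtCoeff (J + 1) / (1 - s₀ ^ 2) * ((2 * J + 1)‼ : ℝ) / 4 ^ (J + 1)
    + √(2 * π) * Real.exp (-(2 * T * s₀ ^ 2)) * T ^ ((J : ℝ) + 3 / 2)
        * (1 + 2 / π * ∑ i ∈ range (bracketDeg m J), |bracketCoeff m J i|
            * (1 / (2 * s₀) * complSum i (s₀ ^ 2) (2 * T)))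

/-- **SEEDCERT L4 — the certificate form of the large-`u` bracket.**  For `0 < s₀ < 1`, `J : ℕ`,
`T ≥ (J+3/2)/(2s₀²)` and `u ≥ T`:
`|√(2πu) q_u(m) - Σ_i g_i (2i-1)‼/(4u)ⁱ| ≤ bracketEps m J s₀ T · (u^{J+1})⁻¹`.
[cite: FitznerVanDerHofstad2016NoBLE, §5.1.1 (5.2)-(5.5) p. 1089-1090] -/
theorem srwHeatKernel_bracket_eps {u T s₀ : ℝ} (hs₀0 : 0 < s₀) (hs₀1 : s₀ < 1) (m : ℤ) (J : ℕ)
    (hT : ((J : ℝ) + 3 / 2) / (2 * s₀ ^ 2) ≤ T) (hu : T ≤ u) :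
    |√(2 * π * u) * srwHeatKernel u m
        - ∑ i ∈ range (bracketDeg m J), bracketCoeff m J i * ((2 * i - 1)‼ : ℝ) / (4 * u) ^ i|
      ≤ bracketEps m J s₀ T * (u ^ (J + 1))⁻¹ := by
  have hσ : 0 < s₀ ^ 2 := by positivity
  have hT0 : 0 < T := lt_of_lt_of_le (div_pos (by positivity) (by positivity)) hT
  have hu0 : 0 < u := lt_of_lt_of_le hT0 hu
  have hπ : 0 < π := Real.pi_pos
  -- abbreviations
  set W : ℝ := (u ^ (J + 1))⁻¹ with hW
  set K : ℝ := √(2 * π) * Real.exp (-(2 * T * s₀ ^ 2)) * T ^ ((J : ℝ) + 3 / 2) with hK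
  set S : ℝ := ∑ i ∈ range (bracketDeg m J), |bracketCoeff m J i|
    * (1 / (2 * s₀) * complSum i (s₀ ^ 2) (2 * T)) with hS
  have hW0 : 0 < W := by positivity
  have hK0 : 0 ≤ K := by positivity
  have hS0 : 0 ≤ S := Finset.sum_nonneg fun i _ =>
    mul_nonneg (abs_nonneg _) (mul_nonneg (by positivity) (complSum_nonneg i hσ.le (by positivity)))
  have hstep : √u * Real.exp (-(2 * u * s₀ ^ 2))
      ≤ T ^ ((J : ℝ) + 3 / 2) * Real.exp (-(2 * T * s₀ ^ 2)) * W := sqrt_mul_exp_le hσ J hT hu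
  have hsq : √(2 * π * u) = √(2 * π) * √u := Real.sqrt_mul (by positivity) u
  -- the three terms of the generic bracket
  have h1 : invSqrtCoeff (J + 1) / (1 - s₀ ^ 2) * ((2 * J + 1)‼ : ℝ) / (4 * u) ^ (J + 1)
      = invSqrtCoeff (J + 1) / (1 - s₀ ^ 2) * ((2 * J + 1)‼ : ℝ) / 4 ^ (J + 1) * W := by
    rw [hW, mul_pow]
    field_simp
  have h2 : √(2 * π * u) * Real.exp (-(2 * u * s₀ ^ 2)) ≤ K * W := by
    rw [hsq, mul_assoc, hK]
    calc √(2 * π) * (√u * Real.exp (-(2 * u * s₀ ^ 2)))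
        ≤ √(2 * π) * (T ^ ((J : ℝ) + 3 / 2) * Real.exp (-(2 * T * s₀ ^ 2)) * W) :=
          mul_le_mul_of_nonneg_left hstep (Real.sqrt_nonneg _)
      _ = _ := by ring
  have h3 : √(2 * π * u) * (2 / π) * ∑ i ∈ range (bracketDeg m J), |bracketCoeff m J i|
        * (1 / (2 * s₀) * ∫ t in Ioi (s₀ ^ 2), t ^ i * Real.exp (-(2 * u * t)))
      ≤ K * W * (2 / π * S) := by
    have hb : 0 < 2 * u := by positivity
    -- closed form and monotonicity inside the sum
    have hsum : ∑ i ∈ range (bracketDeg m J), |bracketCoeff m J i|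
          * (1 / (2 * s₀) * ∫ t in Ioi (s₀ ^ 2), t ^ i * Real.exp (-(2 * u * t)))
        ≤ Real.exp (-(2 * u * s₀ ^ 2)) * S := by
      rw [hS, Finset.mul_sum]
      refine Finset.sum_le_sum fun i _ => ?_
      rw [integral_pow_mul_exp_neg_mul_Ioi_eq_exp_mul_complSum i (s₀ ^ 2) hb,
        show -(2 * u * s₀ ^ 2) = -(2 * u * (s₀ ^ 2)) by ring]
      have hmono : complSum i (s₀ ^ 2) (2 * u) ≤ complSum i (s₀ ^ 2) (2 * T) :=
        complSum_anti i hσ.le (by positivity) (by linarith)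
      have hE : 0 ≤ Real.exp (-(2 * u * s₀ ^ 2)) := (Real.exp_pos _).le
      calc |bracketCoeff m J i| * (1 / (2 * s₀) * (Real.exp (-(2 * u * s₀ ^ 2))
            * complSum i (s₀ ^ 2) (2 * u)))
          ≤ |bracketCoeff m J i| * (1 / (2 * s₀) * (Real.exp (-(2 * u * s₀ ^ 2))
            * complSum i (s₀ ^ 2) (2 * T))) := by gcongr
        _ = _ := by ring
    calc √(2 * π * u) * (2 / π) * ∑ i ∈ range (bracketDeg m J), |bracketCoeff m J i|
          * (1 / (2 * s₀) * ∫ t in Ioi (s₀ ^ 2), t ^ i * Real.exp (-(2 * u * t)))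
        ≤ √(2 * π * u) * (2 / π) * (Real.exp (-(2 * u * s₀ ^ 2)) * S) :=
          mul_le_mul_of_nonneg_left hsum (by positivity)
      _ = √(2 * π) * (√u * Real.exp (-(2 * u * s₀ ^ 2))) * (2 / π * S) := by rw [hsq]; ring
      _ ≤ √(2 * π) * (T ^ ((J : ℝ) + 3 / 2) * Real.exp (-(2 * T * s₀ ^ 2)) * W) * (2 / π * S) := by
          gcongr
      _ = K * W * (2 / π * S) := by rw [hK]; ring
  -- assemble
  have hgen := srwHeatKernel_bracket hu0 hs₀0 hs₀1 m J
  calc |√(2 * π * u) * srwHeatKernel u m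
          - ∑ i ∈ range (bracketDeg m J), bracketCoeff m J i * ((2 * i - 1)‼ : ℝ) / (4 * u) ^ i|
      ≤ invSqrtCoeff (J + 1) / (1 - s₀ ^ 2) * ((2 * J + 1)‼ : ℝ) / 4 ^ (J + 1) * W
          + K * W + K * W * (2 / π * S) := by linarith [hgen, h1, h2, h3]
    _ = bracketEps m J s₀ T * W := by rw [bracketEps, ← hK, ← hS]; ring

end Literature.Probability.LatticeModels
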